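import Summits.QuantumFields.YangMills.Theorems.BalabanLadderIRColdPurityQuarterDoorSU2
import Summits.Ventures.YMGap.RobustBall.StarBoundaryDecayZdGeometric
import HarnessLib

/-!
# Crux `IR` (stmt-QuantumFields-19354), cold-purity currency: the `SU(2)` COLD-PURITY CORNER THROUGH THE VERTEX-STAR DOOR
# `0 ≤ β_W ≤ 9/25` — `δᶜ_β(L) ≤ (L·L·L·2⌊L/4⌋·6) · 1024√2 · R_G(β_W)^{⌊⌊(⌊L/4⌋−3)/2⌋/4⌋} · β` (tree coupling `β = β_W/2`)

Helper file (`--supports stmt-QuantumFields-19354`, helper class; no registered stub claimed) of the pooled IR prover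
`ym-ir-line-pool-p3` (g6): tier C of `Cruxes/IR/PURITY-CORNER-TRANSPORT-idea3g13.md` (the note lists the influence form of the
star door as missing; it IS in the tree: `RobustBall.su2_wilson_boundary_star_geometric`, the Dobrushin–Shlosman vertex-star
window of Lemma G transferred to `ℤ⁴` — every finite-volume `SU(2)` Wilson distribution with any boundary field is within
`2√2 · K · #Δ · R_G(β_W)^{⌊m/4⌋}` of every DLR state on Lipschitz cylinders at depth `m` of a depth function, for EVERY
`0 ≤ β_W ≤ 9/25`, `R_G` the gauge-fixed star received sum, `R_G < 1` iff `β_W < (√37−5)/3 = 0.3609…`).  The assembly is the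
generic pair-bound pipeline of `BalabanLadderIRColdPurityQuarterDoorSU2.lean` (`negLogColdRatio_le_of_pairBound`,
`coldDefect_le_negLogColdRatio`) over the local DLR equations of the anisotropic torus (`WilsonFinTorusPeriodicLift`):
* §1 `gaugeR_mono` (monotone on `[0, 9/25]`), the depth function `m + 1 − ‖x − y‖_∞` of the window, and
  `su2_abs_kernel_plaquetteActionObs_sub_le_star` — two exteriors of the window kernel differ on the plaquette density by
  `≤ 1024√2 · R_G(β_W)^{⌊m/4⌋}` (`m ≥ 1`);
* §2 `su2_abs_plaquetteActionObs_sub_le_star` (two tori), **`su2_coldDefect_le_of_starDoor`** (`0 ≤ β`, `2β ≤ 9/25`, `L ≥ 20`) and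
  **`su2_coldExitAt_corner_of_starDoor`** (∀ `β₁` with `2β₁ ≤ 9/25` ∀ `θ > 0` ∃ `L₀` ∀ `β ∈ [0, β₁]` ∀ `L ≥ L₀`: `δᶜ_β(L) ≤ θ`).
READING (arithmetic on the landed majorant, «∀ L ≥ L₀» checked to 2·10⁵): `δᶜ ≤ 1/24` for all `L ≥ 1356 / 2156 / 4332 / 10508 /
28908` at `β_W ≤ 0.20 / 0.25 / 0.30 / 1/3 / 0.35` (`R_G = 0.40 / 0.55 / 0.73 / 0.87 / 0.95`); beyond the quarter door `2/9` of the
`SU(2)` file and better than it from `β_W ≈ 0.17` on (rate `R_G^{1/4}` per window step vs `9β_W/2`).  The THEOREM-certified `SU(2)`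
cold-purity corner thus reaches `β_W = 0.35`, ≈ 6× below the crossover `β_W ≈ 2.2` where `PX(1/24)` is owed; `L₀ ↑ ∞` at `0.3609`.
HONEST FRAMING.  A strong-coupling FORMAT rung (the Dobrushin–Shlosman uniqueness regime of `SU(2)`), opposite corner to
`ColdExitAt θ`'s `∀ β ≥ β₁ ∃ L`.  Nothing here proves `BalabanLadder.IR` (0/1), a lattice mass gap, confinement, or the Yang–Mills
mass gap (Clay); R4 closes only the conditional finite-𝕋⁴ rung `BalabanLadder.UV`.
-/

set_option autoImplicit false

noncomputable section

namespace Summit.QuantumFields.YangMills.Cruxes.IR.ColdPurityDobrushin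

open MeasureTheory Filter Topology Finset
open scoped NNReal
open Literature.MathematicalPhysics.QuantumFieldTheory hiding ZdEdge
open Literature.MathematicalPhysics.QuantumLattice
open Summit.QuantumFields.YangMills.Cruxes.IR.ColdPurityBridge (coldDefect)
open Summit.Ventures.YMGap.RobustBall (su2_wilson_boundary_star_geometric)
open Summit.Ventures.YMGap.StarWindowGauge (gaugeR Delta gaugeR_lt_one_of_le)
open Summit.Ventures.YMGap.StarLemmaG (gaugeR_nonneg)
/-! ## §1 The star received sum is monotone; the window depth function; two exteriors -/
section Kernel

/-- `R_G` is monotone on `[0, 9/25]` (numerator `6c(1+c)` increasing, denominator `1 − 4c − 6c²` positive and decreasing,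
`c = β_W/4`). -/
theorem gaugeR_mono {b β : ℝ} (hb0 : 0 ≤ b) (hbβ : b ≤ β) (hβ : β ≤ 9 / 25) : gaugeR b ≤ gaugeR β := by
  unfold gaugeR Delta
  have hΔβ : 0 < 1 - 4 * (β / 4) - 6 * (β / 4) ^ 2 := by nlinarith
  have hΔb : 0 < 1 - 4 * (b / 4) - 6 * (b / 4) ^ 2 := by nlinarith
  rw [div_le_div_iff₀ hΔb hΔβ]
  nlinarith [mul_nonneg hb0 (sub_nonneg.2 hbβ), mul_nonneg (mul_nonneg hb0 hb0) (sub_nonneg.2 hbβ),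
    mul_nonneg (mul_nonneg hb0 (by linarith : (0:ℝ) ≤ β)) (sub_nonneg.2 hbβ)]

/-- Links of a plaquette based at `y` are at sup-distance `≤ 1` (real norm) from `y`. -/
theorem norm_sub_le_one_of_mem_plaquetteEdges (p : ZdPlaquette 4)
    {z : Literature.MathematicalPhysics.QuantumLattice.ZdEdge 4} (hz : z ∈ plaquetteEdges p) : ‖z.1 - p.1‖ ≤ 1 := by
  rw [pi_norm_le_iff_of_nonneg zero_le_one]
  intro k
  have h := coord_bounds_of_mem_plaquetteEdges p hz k
  rw [Pi.sub_apply, Int.norm_eq_abs, Int.cast_sub]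
  rw [abs_le]
  constructor
  · have : ((p.1 k : ℤ) : ℝ) ≤ ((z.1 k : ℤ) : ℝ) := by exact_mod_cast h.1
    linarith
  · have : ((z.1 k : ℤ) : ℝ) ≤ ((p.1 k : ℤ) : ℝ) + 1 := by exact_mod_cast h.2
    linarith

/-- **Boundary influence on the plaquette density, `SU(2)`, vertex-star door** (`0 ≤ β_W ≤ 9/25`, tree coupling `β_W/2`; window of
half-width `m ≥ 1` around the base point of `p`): two exteriors differ by at most `1024√2 · R_G(β_W)^{⌊m/4⌋}`. -/
theorem su2_abs_kernel_plaquetteActionObs_sub_le_star {βW : ℝ} (h0 : 0 ≤ βW) (h : βW ≤ 9 / 25)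
    (p : ZdPlaquette 4) {m : ℕ} (hm1 : 1 ≤ m) {Λ : Finset (Literature.MathematicalPhysics.QuantumLattice.ZdEdge 4)}
    (hΛ : Λ = (Fintype.piFinset fun k => Finset.Icc (p.1 k - m) (p.1 k + m)) ×ˢ (Finset.univ : Finset (Fin 4)))
    (ω η : LGConfig 4 (Matrix.specialUnitaryGroup (Fin 2) ℂ)) :
    |(∫ U, plaquetteActionObs (fundamentalRep (Fin 2)) p U
        ∂(ymSpecification (d := 4) (fundamentalRep (Fin 2)) (βW / 2) Λ ω)) -
        ∫ U, plaquetteActionObs (fundamentalRep (Fin 2)) p U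
          ∂(ymSpecification (d := 4) (fundamentalRep (Fin 2)) (βW / 2) Λ η)| ≤
      1024 * Real.sqrt 2 * gaugeR βW ^ (m / 4) := by
  classical
  haveI : SecondCountableTopology (Matrix (Fin 2) (Fin 2) ℂ) :=
    inferInstanceAs (SecondCountableTopology (Fin 2 → Fin 2 → ℂ))
  haveI : SecondCountableTopology (Matrix.specialUnitaryGroup (Fin 2) ℂ) :=
    Topology.IsEmbedding.subtypeVal.secondCountableTopology
  have hcont : Continuous (fundamentalRep (Fin 2)) := continuous_fundamentalRep (Fin 2)
  obtain ⟨μ, hμlim⟩ := infiniteVolumeLimitPoints_nonempty_holds (d := 4) (fundamentalRep (Fin 2)) hcont (βW / 2)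
  have hμ : μ ∈ ymGibbsMeasures (d := 4) (fundamentalRep (Fin 2)) (βW / 2) :=
    mem_ymGibbsMeasures_of_mem_infiniteVolumeLimitPoints_holds (d := 4) (fundamentalRep (Fin 2)) hcont hμlim
  have hL := isLipschitzCylinder_zdPlaquetteObs (N := 2) (d := 4) p.1 (i := p.2.1.1) (j := p.2.1.2) p.2.2
  -- the depth function of the window
  set φ : Literature.MathematicalPhysics.QuantumLattice.ZdEdge 4 → ℝ := fun x => (m : ℝ) + 1 - ‖x.1 - p.1‖ with hφ
  have hφlip : ∀ x y : Literature.MathematicalPhysics.QuantumLattice.ZdEdge 4, φ x ≤ φ y + ‖x.1 - y.1‖ := by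
    intro x y
    simp only [hφ]
    have := norm_sub_le_norm_sub_add_norm_sub y.1 x.1 p.1
    rw [norm_sub_rev y.1 x.1] at this
    linarith
  have hφΛ : ∀ x, 0 < φ x → x ∈ Λ := by
    intro x hx
    simp only [hφ] at hx
    refine mem_window_of_floor_norm_le p.1 m hΛ ?_
    have h1 : ‖x.1 - p.1‖ < (m : ℝ) + 1 := by linarith
    have h2 : ⌊‖x.1 - p.1‖⌋₊ < m + 1 := (Nat.floor_lt (norm_nonneg _)).2 (by exact_mod_cast h1)
    omega
  have hΔ : plaquetteEdges ((p.1, ⟨(p.2.1.1, p.2.1.2), p.2.2⟩) : ZdPlaquette 4) ⊆ Λ := fun z hz =>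
    mem_window_of_floor_norm_le p.1 m hΛ ((floor_norm_sub_le_one_of_mem_plaquetteEdges hz).trans hm1)
  have hmΔ : ∀ x ∈ plaquetteEdges ((p.1, ⟨(p.2.1.1, p.2.1.2), p.2.2⟩) : ZdPlaquette 4), (m : ℝ) ≤ φ x := by
    intro x hx
    simp only [hφ]
    have := norm_sub_le_one_of_mem_plaquetteEdges p hx
    linarith
  have hfl : ⌊(m : ℝ) / ((4 : ℕ) : ℝ)⌋₊ = m / 4 := by
    rw [Nat.floor_div_natCast, Nat.floor_natCast]
  have hb : ∀ ξ : LGConfig 4 (Matrix.specialUnitaryGroup (Fin 2) ℂ),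
      |(∫ U, zdPlaquetteObs (d := 4) (fundamentalRep (Fin 2)) p.1 p.2.1.1 p.2.1.2 U
          ∂(ymSpecification (d := 4) (fundamentalRep (Fin 2)) (βW / 2) Λ ξ)) -
        ∫ U, zdPlaquetteObs (d := 4) (fundamentalRep (Fin 2)) p.1 p.2.1.1 p.2.1.2 U ∂μ| ≤
        2 * Real.sqrt 2 * (4 * (2 : ℝ≥0) ^ 3 : ℝ≥0) * 4 * gaugeR βW ^ (m / 4) := by
    intro ξ
    have key := su2_wilson_boundary_star_geometric h0 h hμ Λ ξ φ hφlip hφΛ hL hΔ hmΔ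
    rw [hfl] at key
    refine key.trans ?_
    have hcard : ((plaquetteEdges ((p.1, ⟨(p.2.1.1, p.2.1.2), p.2.2⟩) : ZdPlaquette 4)).card : ℝ) ≤ 4 := by
      exact_mod_cast card_plaquetteEdges_le _
    have hR0 : 0 ≤ gaugeR βW := gaugeR_nonneg h0 (by linarith)
    have h0' : (0 : ℝ) ≤ 2 * Real.sqrt 2 * (4 * (2 : ℝ≥0) ^ 3 : ℝ≥0) := by positivity
    have hp : (0 : ℝ) ≤ gaugeR βW ^ (m / 4) := pow_nonneg hR0 _
    calc 2 * Real.sqrt 2 * ((4 * (2 : ℝ≥0) ^ 3 : ℝ≥0) : ℝ) *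
          ((plaquetteEdges ((p.1, ⟨(p.2.1.1, p.2.1.2), p.2.2⟩) : ZdPlaquette 4)).card : ℝ) * gaugeR βW ^ (m / 4)
        = (2 * Real.sqrt 2 * ((4 * (2 : ℝ≥0) ^ 3 : ℝ≥0) : ℝ)) *
            (((plaquetteEdges ((p.1, ⟨(p.2.1.1, p.2.1.2), p.2.2⟩) : ZdPlaquette 4)).card : ℝ) * gaugeR βW ^ (m / 4)) := by
          ring
      _ ≤ (2 * Real.sqrt 2 * ((4 * (2 : ℝ≥0) ^ 3 : ℝ≥0) : ℝ)) * (4 * gaugeR βW ^ (m / 4)) :=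
          mul_le_mul_of_nonneg_left (mul_le_mul_of_nonneg_right hcard hp) h0'
      _ = 2 * Real.sqrt 2 * ((4 * (2 : ℝ≥0) ^ 3 : ℝ≥0) : ℝ) * 4 * gaugeR βW ^ (m / 4) := by ring
  -- linearity against the probability kernels (`2 − 2·(normalised observable)`)
  have hzc : Continuous (zdPlaquetteObs (d := 4) (fundamentalRep (Fin 2)) p.1 p.2.1.1 p.2.1.2 :
      LGConfig 4 (Matrix.specialUnitaryGroup (Fin 2) ℂ) → ℝ) := by
    have hc := continuous_plaquetteObs (fundamentalRep (Fin 2)) hcont p.1 p.2.1.1 p.2.1.2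
      (G := Matrix.specialUnitaryGroup (Fin 2) ℂ) (d := 4)
    have h2 : (zdPlaquetteObs (d := 4) (fundamentalRep (Fin 2)) p.1 p.2.1.1 p.2.1.2 :
        LGConfig 4 (Matrix.specialUnitaryGroup (Fin 2) ℂ) → ℝ) =
        fun U => (2 : ℝ)⁻¹ * plaquetteObs (fundamentalRep (Fin 2)) p.1 p.2.1.1 p.2.1.2 U := by
      funext U
      unfold zdPlaquetteObs plaquetteObs
      rw [show ((2 : ℕ) : ℝ) = 2 by norm_num]
      rfl
    rw [h2]
    exact continuous_const.mul hc
  have hzb : ∀ U : LGConfig 4 (Matrix.specialUnitaryGroup (Fin 2) ℂ),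
      |zdPlaquetteObs (d := 4) (fundamentalRep (Fin 2)) p.1 p.2.1.1 p.2.1.2 U| ≤ 1 := fun U =>
    abs_zdPlaquetteObs_le (fun g => fundamentalRep_mem_unitaryGroup g) _ _ _ U
  have hlin : ∀ ξ : LGConfig 4 (Matrix.specialUnitaryGroup (Fin 2) ℂ),
      ∫ U, plaquetteActionObs (fundamentalRep (Fin 2)) p U ∂(ymSpecification (d := 4) (fundamentalRep (Fin 2)) (βW / 2) Λ ξ) =
        2 - 2 * ∫ U, zdPlaquetteObs (d := 4) (fundamentalRep (Fin 2)) p.1 p.2.1.1 p.2.1.2 U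
          ∂(ymSpecification (d := 4) (fundamentalRep (Fin 2)) (βW / 2) Λ ξ) := by
    intro ξ
    haveI := isProbabilityMeasure_ymSpecification (d := 4) (fundamentalRep (Fin 2)) hcont (βW / 2) Λ ξ
    simp only [su2_plaquetteActionObs_eq]
    rw [integral_sub (integrable_const _) ((integrable_of_bound hzc.aestronglyMeasurable hzb).const_mul 2),
      integral_const, integral_const_mul]
    simp
  rw [hlin ω, hlin η]
  have e : (2 : ℝ) - 2 * (∫ U, zdPlaquetteObs (d := 4) (fundamentalRep (Fin 2)) p.1 p.2.1.1 p.2.1.2 U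
        ∂(ymSpecification (d := 4) (fundamentalRep (Fin 2)) (βW / 2) Λ ω)) -
      (2 - 2 * ∫ U, zdPlaquetteObs (d := 4) (fundamentalRep (Fin 2)) p.1 p.2.1.1 p.2.1.2 U
        ∂(ymSpecification (d := 4) (fundamentalRep (Fin 2)) (βW / 2) Λ η)) =
      -2 * (((∫ U, zdPlaquetteObs (d := 4) (fundamentalRep (Fin 2)) p.1 p.2.1.1 p.2.1.2 U
          ∂(ymSpecification (d := 4) (fundamentalRep (Fin 2)) (βW / 2) Λ ω)) -
          ∫ U, zdPlaquetteObs (d := 4) (fundamentalRep (Fin 2)) p.1 p.2.1.1 p.2.1.2 U ∂μ) -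
        ((∫ U, zdPlaquetteObs (d := 4) (fundamentalRep (Fin 2)) p.1 p.2.1.1 p.2.1.2 U
          ∂(ymSpecification (d := 4) (fundamentalRep (Fin 2)) (βW / 2) Λ η)) -
          ∫ U, zdPlaquetteObs (d := 4) (fundamentalRep (Fin 2)) p.1 p.2.1.1 p.2.1.2 U ∂μ)) := by ring
  rw [e, abs_mul, abs_neg, abs_two]
  have h2 := (abs_sub _ _).trans (add_le_add (hb ω) (hb η))
  have hconst : ((4 * (2 : ℝ≥0) ^ 3 : ℝ≥0) : ℝ) = 32 := by push_cast; norm_num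
  rw [hconst] at h2
  have hR0 : 0 ≤ gaugeR βW := gaugeR_nonneg h0 (by linarith)
  nlinarith [h2, Real.sqrt_nonneg 2, pow_nonneg hR0 (m / 4)]
end Kernel
/-! ## §2 Two tori, the `SU(2)` star-door corner, and its uniform form -/
section Corner

/-- **One-point torus-size difference, `SU(2)`, vertex-star door** (`0 ≤ β_W ≤ 9/25`; `1 ≤ m`, `2m + 2 < L, T₁, T₂`). -/
theorem su2_abs_plaquetteActionObs_sub_le_star {βW : ℝ} (h0 : 0 ≤ βW) (h : βW ≤ 9 / 25)
    {L T₁ T₂ : ℕ} [NeZero L] [NeZero T₁] [NeZero T₂] {m : ℕ} (hm1 : 1 ≤ m) (hL : 2 * m + 2 < L)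
    (hT₁ : 2 * m + 2 < T₁) (hT₂ : 2 * m + 2 < T₂) (p : ZdPlaquette 4) :
    |finTorusExpectation (fundamentalRep (Fin 2)) (βW / 2)
          (fun V : FinTorusSite L L L T₁ × Fin 4 → Matrix.specialUnitaryGroup (Fin 2) ℂ =>
            plaquetteActionObs (fundamentalRep (Fin 2)) p (finTorusLift L T₁ V)) -
        finTorusExpectation (fundamentalRep (Fin 2)) (βW / 2)
          (fun V : FinTorusSite L L L T₂ × Fin 4 → Matrix.specialUnitaryGroup (Fin 2) ℂ =>
            plaquetteActionObs (fundamentalRep (Fin 2)) p (finTorusLift L T₂ V))| ≤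
      1024 * Real.sqrt 2 * gaugeR βW ^ (m / 4) := by
  haveI : SecondCountableTopology (Matrix (Fin 2) (Fin 2) ℂ) :=
    inferInstanceAs (SecondCountableTopology (Fin 2 → Fin 2 → ℂ))
  haveI : SecondCountableTopology (Matrix.specialUnitaryGroup (Fin 2) ℂ) :=
    Topology.IsEmbedding.subtypeVal.secondCountableTopology
  have hcont : Continuous (fundamentalRep (Fin 2)) := continuous_fundamentalRep (Fin 2)
  obtain ⟨Λ, hΛ⟩ : ∃ Λ : Finset (Literature.MathematicalPhysics.QuantumLattice.ZdEdge 4),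
      Λ = (Fintype.piFinset fun k => Finset.Icc (p.1 k - m) (p.1 k + m)) ×ˢ (Finset.univ : Finset (Fin 4)) :=
    ⟨_, rfl⟩
  exact abs_finTorusExpectation_lift_sub_lift_le (fundamentalRep (Fin 2)) hcont (βW / 2) Λ
    (continuous_plaquetteActionObs (fundamentalRep (Fin 2)) hcont p)
    (abs_plaquetteActionObs_le (fundamentalRep (Fin 2)) (fun g => fundamentalRep_mem_unitaryGroup g) p)
    (isCylinder_plaquetteActionObs (fundamentalRep (Fin 2)) p) (injOn_windowClosure p.1 m p.2 hΛ hL hT₁)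
    (injOn_windowClosure p.1 m p.2 hΛ hL hT₂) (su2_abs_kernel_plaquetteActionObs_sub_le_star h0 h p hm1 hΛ)

/-- **`SU(2)` COLD-PURITY CORNER THROUGH THE VERTEX-STAR DOOR.**  For the fundamental representation of `SU(2)`, every tree
coupling `0 ≤ β` with `2β ≤ 9/25` (`β_W = 2β ≤ 0.36`) and every `L ≥ 20`:
`δᶜ_β(L) ≤ (L·L·L·2⌊L/4⌋·6) · (1024√2 · R_G(2β)^{⌊⌊(⌊L/4⌋−3)/2⌋/4⌋}) · β`.  (FORMAT rung, strong coupling.) -/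
theorem su2_coldDefect_le_of_starDoor {β : ℝ} (h0 : 0 ≤ β) (hβ : 2 * β ≤ 9 / 25) {L : ℕ} (hL : 20 ≤ L) :
    coldDefect (fundamentalLatticeRep 2).ρ β L ≤
      ((L * L * L * (2 * (L / 4)) : ℕ) : ℝ) * 6 * (1024 * Real.sqrt 2 * gaugeR (2 * β) ^ ((((L / 4) - 3) / 2) / 4)) * β := by
  haveI : NeZero L := ⟨by omega⟩
  haveI : NeZero (L / 4) := ⟨by omega⟩
  haveI : NeZero (2 * (L / 4)) := ⟨by omega⟩
  have hk0 : 1 ≤ (L / 4 - 3) / 2 := by omega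
  have hk1 : 2 * ((L / 4 - 3) / 2) + 2 < L := by omega
  have hk2 : 2 * ((L / 4 - 3) / 2) + 2 < L / 4 := by omega
  have hk3 : 2 * ((L / 4 - 3) / 2) + 2 < 2 * (L / 4) := by omega
  refine (coldDefect_le_negLogColdRatio (fundamentalLatticeRep 2) β L).trans ?_
  refine negLogColdRatio_le_of_pairBound (fundamentalLatticeRep 2) h0 (t := L / 4) fun b hb' x q => ?_
  have hb0 : 0 ≤ 2 * b := by linarith [hb'.1]
  have hb9 : 2 * b ≤ 9 / 25 := by linarith [hb'.2]
  have h := su2_abs_plaquetteActionObs_sub_le_star hb0 hb9 (T₁ := 2 * (L / 4)) (T₂ := L / 4) hk0 hk1 hk3 hk2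
    ((finTorusRepr x, q) : ZdPlaquette 4)
  rw [mul_div_cancel_left₀ b two_ne_zero] at h
  simp only [plaquetteActionObs_finTorusLift, finTorusProjSite_finTorusRepr] at h
  refine h.trans ?_
  have hmono : gaugeR (2 * b) ^ ((((L / 4) - 3) / 2) / 4) ≤ gaugeR (2 * β) ^ ((((L / 4) - 3) / 2) / 4) :=
    pow_le_pow_left₀ (gaugeR_nonneg hb0 (by linarith)) (gaugeR_mono hb0 (by linarith [hb'.2]) hβ) _
  have hs : (0 : ℝ) ≤ 1024 * Real.sqrt 2 := by positivity
  exact mul_le_mul_of_nonneg_left hmono hs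

/-- A polynomial-times-geometric majorant with the QUARTER-speed exponent is eventually small: for `0 < c < 1`, `0 ≤ A` and
`θ > 0` there is `L₀` with `A · (L·L·L·2⌊L/4⌋) · c^{⌊⌊(⌊L/4⌋−3)/2⌋/4⌋} ≤ θ` for all `L ≥ L₀`. -/
theorem eventually_volume_mul_pow_quarter_le {c A θ : ℝ} (hc0 : 0 < c) (hc1 : c < 1) (hA : 0 ≤ A) (hθ : 0 < θ) :
    ∃ L₀ : ℕ, ∀ L : ℕ, L₀ ≤ L →
      A * ((L * L * L * (2 * (L / 4)) : ℕ) : ℝ) * c ^ ((((L / 4) - 3) / 2) / 4) ≤ θ := by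
  have hlim : Tendsto (fun j : ℕ => ((j + 1 : ℕ) : ℝ) ^ 4 * c ^ (j + 1)) atTop (𝓝 0) :=
    (tendsto_pow_const_mul_const_pow_of_abs_lt_one 4 (by rwa [abs_of_pos hc0])).comp (tendsto_add_atTop_nat 1)
  have hlim' : Tendsto (fun j : ℕ => A * (2 * 32 ^ 4) * (c ^ 2)⁻¹ * (((j + 1 : ℕ) : ℝ) ^ 4 * c ^ (j + 1)))
      atTop (𝓝 (A * (2 * 32 ^ 4) * (c ^ 2)⁻¹ * 0)) := hlim.const_mul _
  rw [mul_zero] at hlim'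
  obtain ⟨j₀, hj₀⟩ := eventually_atTop.1 ((tendsto_order.1 hlim').2 θ hθ)
  refine ⟨32 * j₀, fun L hL => ?_⟩
  set j : ℕ := L / 32 with hj
  have hjj : j₀ ≤ j := by omega
  have hb := (hj₀ j hjj).le
  have hc2 : 0 < c ^ 2 := pow_pos hc0 2
  have hLj : (L : ℝ) ≤ 32 * ((j + 1 : ℕ) : ℝ) := by
    have : L ≤ 32 * (j + 1) := by omega
    exact_mod_cast this
  have hk : c ^ ((((L / 4) - 3) / 2) / 4) ≤ (c ^ 2)⁻¹ * c ^ (j + 1) := by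
    have hle : j + 1 ≤ (((L / 4) - 3) / 2) / 4 + 2 := by omega
    have h1 : c ^ ((((L / 4) - 3) / 2) / 4 + 2) ≤ c ^ (j + 1) := pow_le_pow_of_le_one hc0.le hc1.le hle
    rw [pow_add] at h1
    rw [le_inv_mul_iff₀ hc2]
    linarith
  have hL0 : (0 : ℝ) ≤ L := Nat.cast_nonneg _
  have hvol : ((L * L * L * (2 * (L / 4)) : ℕ) : ℝ) ≤ 2 * (32 * ((j + 1 : ℕ) : ℝ)) ^ 4 := by
    rw [Nat.cast_mul, Nat.cast_mul, Nat.cast_mul]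
    have ht : ((2 * (L / 4) : ℕ) : ℝ) ≤ 2 * L := by
      have : 2 * (L / 4) ≤ 2 * L := by omega
      exact_mod_cast this
    have h3 : (L : ℝ) * L * L ≤ (32 * ((j + 1 : ℕ) : ℝ)) ^ 3 := by
      have := pow_le_pow_left₀ hL0 hLj 3
      nlinarith [this]
    have ht' : ((2 * (L / 4) : ℕ) : ℝ) ≤ 2 * (32 * ((j + 1 : ℕ) : ℝ)) := ht.trans (by linarith)
    calc (L : ℝ) * L * L * ((2 * (L / 4) : ℕ) : ℝ) ≤ (32 * ((j + 1 : ℕ) : ℝ)) ^ 3 * (2 * (32 * ((j + 1 : ℕ) : ℝ))) :=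
          mul_le_mul h3 ht' (Nat.cast_nonneg _) (by positivity)
      _ = 2 * (32 * ((j + 1 : ℕ) : ℝ)) ^ 4 := by ring
  have hpk : (0 : ℝ) ≤ c ^ ((((L / 4) - 3) / 2) / 4) := pow_nonneg hc0.le _
  calc A * ((L * L * L * (2 * (L / 4)) : ℕ) : ℝ) * c ^ ((((L / 4) - 3) / 2) / 4)
      ≤ A * (2 * (32 * ((j + 1 : ℕ) : ℝ)) ^ 4) * ((c ^ 2)⁻¹ * c ^ (j + 1)) := by gcongr
    _ = A * (2 * 32 ^ 4) * (c ^ 2)⁻¹ * (((j + 1 : ℕ) : ℝ) ^ 4 * c ^ (j + 1)) := by ring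
    _ ≤ θ := hb

/-- **UNIFORM `SU(2)` CORNER THROUGH THE VERTEX-STAR DOOR**: for every `β₁` with `0 ≤ β₁`, `2β₁ ≤ 9/25` and every `θ > 0` there is an
explicit `L₀` (depending on `β₁` through `R_G(2β₁) < 1`) such that `δᶜ_β(L) ≤ θ` for every `β ∈ [0, β₁]` and every `L ≥ L₀` — the whole
Dobrushin–Shlosman vertex-star window `β_W ≤ 9/25` of `SU(2)`.  (FORMAT rung; opposite corner to `ColdExitAt`.) -/
theorem su2_coldExitAt_corner_of_starDoor {β₁ : ℝ} (h1 : 0 ≤ β₁) (hβ₁ : 2 * β₁ ≤ 9 / 25) {θ : ℝ} (hθ : 0 < θ) :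
    ∃ L₀ : ℕ, ∀ β : ℝ, 0 ≤ β → β ≤ β₁ → ∀ L : ℕ, L₀ ≤ L → coldDefect (fundamentalLatticeRep 2).ρ β L ≤ θ := by
  have hR1 : gaugeR (2 * β₁) < 1 := gaugeR_lt_one_of_le (by linarith) hβ₁
  have hR0 : 0 ≤ gaugeR (2 * β₁) := gaugeR_nonneg (by linarith) (by linarith)
  -- use the base `c = max (R_G(2β₁)) (1/2) ∈ (0,1)` to cover `R_G = 0` at `β₁ = 0`
  have hc0 : 0 < max (gaugeR (2 * β₁)) (1 / 2) := lt_max_of_lt_right (by norm_num)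
  have hc1 : max (gaugeR (2 * β₁)) (1 / 2) < 1 := max_lt hR1 (by norm_num)
  obtain ⟨L₀, hL₀⟩ := eventually_volume_mul_pow_quarter_le (A := 6 * (1024 * Real.sqrt 2) * β₁) hc0 hc1
    (by positivity) hθ
  refine ⟨max L₀ 20, fun β h0 hβ L hL => ?_⟩
  have hmain := su2_coldDefect_le_of_starDoor h0 (by linarith) (le_trans (le_max_right _ _) hL)
  refine hmain.trans (le_trans ?_ (hL₀ L (le_trans (le_max_left _ _) hL)))
  have hV : (0 : ℝ) ≤ ((L * L * L * (2 * (L / 4)) : ℕ) : ℝ) := Nat.cast_nonneg _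
  have hRβ0 : 0 ≤ gaugeR (2 * β) := gaugeR_nonneg (by linarith) (by linarith)
  have hP : gaugeR (2 * β) ^ ((((L / 4) - 3) / 2) / 4) ≤ (max (gaugeR (2 * β₁)) (1 / 2)) ^ ((((L / 4) - 3) / 2) / 4) :=
    pow_le_pow_left₀ hRβ0 ((gaugeR_mono (by linarith) (by linarith) hβ₁).trans (le_max_left _ _)) _
  have hP0 : (0 : ℝ) ≤ (max (gaugeR (2 * β₁)) (1 / 2)) ^ ((((L / 4) - 3) / 2) / 4) := pow_nonneg hc0.le _
  have hs : (0 : ℝ) ≤ 1024 * Real.sqrt 2 := by positivity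
  calc ((L * L * L * (2 * (L / 4)) : ℕ) : ℝ) * 6 * (1024 * Real.sqrt 2 * gaugeR (2 * β) ^ ((((L / 4) - 3) / 2) / 4)) * β
      ≤ ((L * L * L * (2 * (L / 4)) : ℕ) : ℝ) * 6 *
          (1024 * Real.sqrt 2 * (max (gaugeR (2 * β₁)) (1 / 2)) ^ ((((L / 4) - 3) / 2) / 4)) * β₁ := by
        gcongr
    _ = 6 * (1024 * Real.sqrt 2) * β₁ * ((L * L * L * (2 * (L / 4)) : ℕ) : ℝ) *
          (max (gaugeR (2 * β₁)) (1 / 2)) ^ ((((L / 4) - 3) / 2) / 4) := by ring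
end Corner

end Summit.QuantumFields.YangMills.Cruxes.IR.ColdPurityDobrushin

end
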